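import Literature.Computability.AlgebraicComplexity.FlipGraphMoves
import Literature.Computability.AlgebraicComplexity.FlipGraphSymmetry
import HarnessLib

/-!
# Kauers–Moosbauer flip graphs: flips and reductions are compatible with the symmetry group

Topic `Literature/Computability/AlgebraicComplexity`; companion of `FlipGraphConnectivity.lean`
(KM Def. 4 / Prop. 3 as the relations `Flips`, `Reduces` on multisets of tensors; Def. 8) and
`FlipGraphSymmetry.lean` (the symmetries of `⟨n,n,n⟩`). Source: Kauers–Moosbauer, ISSAC 2023 =
arXiv:2212.01175 (KM), the two printed compatibility statements:

* §2, after Def. 2: "Def. 2 is compatible with the action of the symmetry group. For permutations,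
  this is because the definition explicitly allows any two factors to take the roles of `A` and
  `B`, and linear dependence is preserved under transposition. Likewise, if some matrices `B^{(i)}`
  (`i ∈ I`) are linearly dependent, then so are the matrices `V B^{(i)} W^{-1}` (`i ∈ I`) for any
  invertible matrices `V, W`. Therefore, we can extend Def. 2 from individual matrix multiplication
  schemes to equivalence classes."
* §3, after Def. 4: "Flips are well-defined for equivalence classes of matrix multiplication schemes
  in the following sense: If `S'` is a flip of `S` and `g` is an element of the symmetry group, then
  `g(S)` is a flip of `g(S')`. This is the case since Def. 4 applies for arbitrary permuations [sic]
  of `A, B, Γ` and because the symmetry transformations act linearly on the individual matrices."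

Everything here is PROVED; no named facts. The symmetry group is generated (KM §2) by the
sandwiches and by the transposition / cyclic shift; accordingly the statements are proved for
(i) every FACTORWISE linear map `T ↦ (A ⊗ B ⊗ C)·T` (`actTensor`; this covers the sandwiches and,
with permutation matrices, index relabelings) and every index relabeling `relabel e₁ e₂ e₃`, and
(ii) the slot permutations `sw₂₃`, `cyc` (hence all of `S₃`), of which KM's transposition and cyclic
shift of `⟨n,n,n⟩` (`transposeMap`, `cycleMap` of `FlipGraphSymmetry.lean`) are composites with a
relabeling. §4: KM's group `G` of `⟨n,n,n⟩` as the predicate `InSymmetryGroup` generated by these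
(and identity, inverses, composites); for every `g ∈ G`, flips / reductions / edges of Def. 8 are
mapped to flips / reductions / edges (`InSymmetryGroup.map_flips`, `.map_reduces`, `.map_adj`); the
orbit relation of `G` (`orbitSetoidKM`), Def. 8 with KM's own vertex set (`flipGraphKM`, edges well
defined: `flipGraphKM_mk_iff`) and Thm. 9 on it (`kauersMoosbauer2023_thm9_orbitsKM`). §5: Def. 2
itself (indexed families, `Reducible` of `FlipGraphMoves.lean`) under injective linear maps of the
factors and under permutations of the factors.

## References

* M. Kauers, J. Moosbauer, *Flip Graphs for Matrix Multiplication*, ISSAC 2023, arXiv:2212.01175,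
  §2 (paragraph after Def. 2), §3 (paragraph after Def. 4). [KauersMoosbauer2022FlipGraphs]
-/

namespace Literature.Computability.AlgebraicComplexity

open scoped BigOperators Kronecker
open Multiset Matrix

namespace FlipGraph

/-! ## §1 Factorwise linear maps of tensors -/

section Factorwise

variable {K : Type*} [CommRing K] {ι κ μ ι' κ' μ' : Type*}

/-- A map of 3-tensors that is additive and acts FACTORWISE on rank-one tensors through additive
maps `F, G, H` of the three factors ("the symmetry transformations act linearly on the individual
matrices", KM §3). [cite: KauersMoosbauer2022FlipGraphs, §3 (paragraph after Def. 4)] -/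
structure IsFactorwise (φ : (ι → κ → μ → K) → (ι' → κ' → μ' → K)) (F : (ι → K) → (ι' → K))
    (G : (κ → K) → (κ' → K)) (H : (μ → K) → (μ' → K)) : Prop where
  map_add : ∀ x y, φ (x + y) = φ x + φ y
  map_triad : ∀ a b c, φ (triad a b c) = triad (F a) (G b) (H c)
  add₁ : ∀ a a', F (a + a') = F a + F a'
  add₂ : ∀ b b', G (b + b') = G b + G b'
  add₃ : ∀ c c', H (c + c') = H c + H c'
  smul₁ : ∀ (r : K) a, F (r • a) = r • F a
  smul₂ : ∀ (r : K) b, G (r • b) = r • G b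
  smul₃ : ∀ (r : K) c, H (r • c) = r • H c

namespace IsFactorwise

variable {φ : (ι → κ → μ → K) → (ι' → κ' → μ' → K)} {F : (ι → K) → (ι' → K)}
  {G : (κ → K) → (κ' → K)} {H : (μ → K) → (μ' → K)}

/-- A factorwise map sends `0` to `0`. [folklore] -/
private theorem map_zero (h : IsFactorwise φ F G H) : φ 0 = 0 := by
  have := h.map_add 0 0
  rw [add_zero] at this
  -- `φ 0 = φ 0 + φ 0`
  have h2 : φ 0 + φ 0 = φ 0 + 0 := by rw [add_zero]; exact this.symm
  exact add_left_cancel h2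

/-- A factorwise map is subtractive. [folklore] -/
private theorem map_sub (h : IsFactorwise φ F G H) (x y : ι → κ → μ → K) :
    φ (x - y) = φ x - φ y := by
  have := h.map_add (x - y) y
  rw [sub_add_cancel] at this
  rw [this, add_sub_cancel_right]

/-- The third factor map is subtractive. [folklore] -/
private theorem sub₃ (h : IsFactorwise φ F G H) (c c' : μ → K) : H (c - c') = H c - H c' := by
  have := h.add₃ (c - c') c'
  rw [sub_add_cancel] at this
  rw [this, add_sub_cancel_right]

/-- The second factor map is subtractive. [folklore] -/
private theorem sub₂ (h : IsFactorwise φ F G H) (b b' : κ → K) : G (b - b') = G b - G b' := by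
  have := h.add₂ (b - b') b'
  rw [sub_add_cancel] at this
  rw [this, add_sub_cancel_right]

/-- The second factor map commutes with multiset sums of scalar multiples. [folklore] -/
private theorem map_sum₂ (h : IsFactorwise φ F G H) {X : Type*} (L : Multiset X) (f : X → κ → K) :
    G (L.map f).sum = (L.map fun q => G (f q)).sum := by
  induction L using Multiset.induction_on with
  | empty =>
    simp only [Multiset.map_zero, Multiset.sum_zero]
    have := h.add₂ 0 0
    rw [add_zero] at this
    have h2 : G 0 + G 0 = G 0 + 0 := by rw [add_zero]; exact this.symm
    exact add_left_cancel h2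
  | cons q L ih => rw [Multiset.map_cons, Multiset.sum_cons, Multiset.map_cons, Multiset.sum_cons,
      h.add₂, ih]

/-- **Flips are preserved by factorwise maps** (the written case of Def. 4): if `S'` is a flip of
`S` sharing the first factor, so is `φ(S')` of `φ(S)`.
[cite: KauersMoosbauer2022FlipGraphs, §3 (paragraph after Def. 4)] -/
theorem flipBase (h : IsFactorwise φ F G H) {S S' : Multiset (ι → κ → μ → K)}
    (hf : FlipBase S S') : FlipBase (S.map φ) (S'.map φ) := by
  obtain ⟨a, b, b', c, c', R, hS, hS'⟩ := hf
  refine ⟨F a, G b, G b', H c, H c', R.map φ, ?_, ?_⟩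
  · rw [hS, Multiset.map_cons, Multiset.map_cons, h.map_triad, h.map_triad]
  · rcases hS' with hS' | hS'
    · left
      simp only [hS', Multiset.map_cons, h.map_add, h.map_sub, h.map_triad]
    · right
      simp only [hS', Multiset.map_cons, h.map_add, h.map_sub, h.map_triad]

/-- **Reductions are preserved by factorwise maps** (the written case of Def. 2 / Prop. 3): KM's
data `(t, I, αᵢ, βᵢ)` are mapped to data for `φ(S)` — "if some matrices `B^{(i)}` are linearly
dependent, then so are the matrices `V B^{(i)} W^{-1}`", and `A^{(t)} = αᵢ A^{(i)}` is preserved by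
linearity. [cite: KauersMoosbauer2022FlipGraphs, §2 (paragraph after Def. 2)] -/
theorem redBase (h : IsFactorwise φ F G H) {S S' : Multiset (ι → κ → μ → K)}
    (hr : RedBase S S') : RedBase (S.map φ) (S'.map φ) := by
  obtain ⟨a₀, b₀, c₀, R, L, L₀, hS, hA, hB, hL₀, hS'⟩ := hr
  let ψ : ((ι → K) × (κ → K) × (μ → K)) × (K × K) → ((ι' → K) × (κ' → K) × (μ' → K)) × (K × K) :=
    fun q => ((F q.1.1, G q.1.2.1, H q.1.2.2), q.2)
  have hmod : ∀ q : ((ι → K) × (κ → K) × (μ → K)) × (K × K),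
      φ (triad q.1.1 q.1.2.1 (q.1.2.2 + (q.2.1 * q.2.2) • c₀)) =
        triad (ψ q).1.1 (ψ q).1.2.1 ((ψ q).1.2.2 + ((ψ q).2.1 * (ψ q).2.2) • H c₀) := by
    intro q
    rw [h.map_triad, h.add₃, h.smul₃]
  refine ⟨F a₀, G b₀, H c₀, R.map φ, L.map ψ, L₀.map ψ, ?_, ?_, ?_, ?_, ?_⟩
  · rw [hS, Multiset.map_cons, h.map_triad, Multiset.map_add φ, ← Multiset.map_add ψ,
      Multiset.map_map, Multiset.map_map]
    congr 2
    exact Multiset.map_congr rfl fun q _ => h.map_triad _ _ _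
  · intro q hq
    rw [← Multiset.map_add, Multiset.mem_map] at hq
    obtain ⟨q', hq', rfl⟩ := hq
    show F a₀ = q'.2.1 • F q'.1.1
    rw [hA q' hq', h.smul₁]
  · rw [hB, h.map_sum₂, ← Multiset.map_add ψ, Multiset.map_map]
    congr 1
    exact Multiset.map_congr rfl fun q _ => h.smul₂ _ _
  · intro q hq
    obtain ⟨q', hq', rfl⟩ := Multiset.mem_map.mp hq
    rw [← hmod, hL₀ q' hq', h.map_zero]
  · rw [hS', Multiset.map_add, Multiset.map_map, Multiset.map_map]
    congr 1
    exact Multiset.map_congr rfl fun q _ => hmod q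

end IsFactorwise

/-- `T ↦ (A ⊗ B ⊗ C)·T` is factorwise with the factor maps `A·`, `B·`, `C·` (`actTensor_triad`).
[cite: KauersMoosbauer2022FlipGraphs, §3 (paragraph after Def. 4)] -/
theorem isFactorwise_actTensor [Fintype ι] [Fintype κ] [Fintype μ] (A : Matrix ι' ι K)
    (B : Matrix κ' κ K) (C : Matrix μ' μ K) :
    IsFactorwise (actTensor A B C) A.mulVec B.mulVec C.mulVec where
  map_add := actTensor_add_tensor A B C
  map_triad := actTensor_triad A B C
  add₁ a a' := Matrix.mulVec_add A a a'
  add₂ b b' := Matrix.mulVec_add B b b'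
  add₃ c c' := Matrix.mulVec_add C c c'
  smul₁ r a := Matrix.mulVec_smul A r a
  smul₂ r b := Matrix.mulVec_smul B r b
  smul₃ r c := Matrix.mulVec_smul C r c

/-- Index relabeling of a 3-tensor along maps `e₁, e₂, e₃` of the index types. [folklore] -/
def relabel (e₁ : ι' → ι) (e₂ : κ' → κ) (e₃ : μ' → μ) (T : ι → κ → μ → K) : ι' → κ' → μ' → K :=
  fun a b c => T (e₁ a) (e₂ b) (e₃ c)

/-- Relabeling is factorwise: `(a ⊗ b ⊗ c) ↦ (a ∘ e₁) ⊗ (b ∘ e₂) ⊗ (c ∘ e₃)`.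
[cite: KauersMoosbauer2022FlipGraphs, §3 (paragraph after Def. 4)] -/
theorem isFactorwise_relabel (e₁ : ι' → ι) (e₂ : κ' → κ) (e₃ : μ' → μ) :
    IsFactorwise (relabel (K := K) e₁ e₂ e₃) (· ∘ e₁) (· ∘ e₂) (· ∘ e₃) where
  map_add _ _ := rfl
  map_triad _ _ _ := rfl
  add₁ _ _ := rfl
  add₂ _ _ := rfl
  add₃ _ _ := rfl
  smul₁ _ _ := rfl
  smul₂ _ _ := rfl
  smul₃ _ _ := rfl

end Factorwise

/-! ## §2 Flips and reductions under factorwise maps (sandwiches, relabelings) -/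

section Transport

variable {K : Type*} [CommRing K] {ι κ μ ι' κ' μ' : Type*}

/-- Transport of a multiset along two commuting squares of maps. [folklore] -/
private theorem map_map_comm {X Y X₁ Y₁ : Type*} {φ : X → Y} {π : X → X₁} {π' : Y → Y₁}
    {φ' : X₁ → Y₁} (h : ∀ T, π' (φ T) = φ' (π T)) (S : Multiset X) :
    (S.map φ).map π' = (S.map π).map φ' := by
  rw [Multiset.map_map, Multiset.map_map]
  exact Multiset.map_congr rfl fun T _ => h T

section Act

variable [Fintype ι] [Fintype κ] [Fintype μ] (A : Matrix ι' ι K) (B : Matrix κ' κ K)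
  (C : Matrix μ' μ K)

/-- `sw₁₂ ((A⊗B⊗C)·T) = (B⊗A⊗C)·(sw₁₂ T)`. [folklore] -/
private theorem sw₁₂_actTensor (T : ι → κ → μ → K) :
    sw₁₂ (actTensor A B C T) = actTensor B A C (sw₁₂ T) := by
  funext b a c
  simp only [sw₁₂, actTensor_apply]
  rw [Finset.sum_comm]
  exact Finset.sum_congr rfl fun _ _ => Finset.sum_congr rfl fun _ _ =>
    Finset.sum_congr rfl fun _ _ => by ring

/-- `sw₂₃ ((A⊗B⊗C)·T) = (A⊗C⊗B)·(sw₂₃ T)`. [folklore] -/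
private theorem sw₂₃_actTensor (T : ι → κ → μ → K) :
    sw₂₃ (actTensor A B C T) = actTensor A C B (sw₂₃ T) := by
  funext a c b
  simp only [sw₂₃, actTensor_apply]
  refine Finset.sum_congr rfl fun _ _ => ?_
  rw [Finset.sum_comm]
  exact Finset.sum_congr rfl fun _ _ => Finset.sum_congr rfl fun _ _ => by ring

/-- `cyc ((A⊗B⊗C)·T) = (B⊗C⊗A)·(cyc T)`. [folklore] -/
private theorem cyc_actTensor (T : ι → κ → μ → K) :
    cyc (actTensor A B C T) = actTensor B C A (cyc T) := by
  funext b c a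
  simp only [cyc, actTensor_apply]
  rw [Finset.sum_comm]
  refine Finset.sum_congr rfl fun _ _ => ?_
  rw [Finset.sum_comm]
  exact Finset.sum_congr rfl fun _ _ => Finset.sum_congr rfl fun _ _ => by ring

/-- `cyc₂ ((A⊗B⊗C)·T) = (C⊗A⊗B)·(cyc₂ T)`. [folklore] -/
private theorem cyc₂_actTensor (T : ι → κ → μ → K) :
    cyc₂ (actTensor A B C T) = actTensor C A B (cyc₂ T) := by
  have h : cyc₂ (actTensor A B C T) = cyc (cyc (actTensor A B C T)) := rfl
  rw [h, cyc_actTensor, cyc_actTensor]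
  rfl

/-- `sw₁₃ ((A⊗B⊗C)·T) = (C⊗B⊗A)·(sw₁₃ T)`. [folklore] -/
private theorem sw₁₃_actTensor (T : ι → κ → μ → K) :
    sw₁₃ (actTensor A B C T) = actTensor C B A (sw₁₃ T) := by
  have h : sw₁₃ (actTensor A B C T) = sw₁₂ (cyc (actTensor A B C T)) := rfl
  rw [h, cyc_actTensor, sw₁₂_actTensor]
  rfl

/-- **"If `S'` is a flip of `S` and `g` is an element of the symmetry group, then `g(S')` is a flip
of `g(S)`"** — for `g = A ⊗ B ⊗ C` acting factorwise (any matrices; in particular every sandwich):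
all three cases of Def. 4. [cite: KauersMoosbauer2022FlipGraphs, §3 (paragraph after Def. 4)] -/
theorem Flips.map_actTensor {S S' : Multiset (ι → κ → μ → K)} (hf : Flips S S') :
    Flips (S.map (actTensor A B C)) (S'.map (actTensor A B C)) := by
  rcases hf with h | h | h
  · exact Or.inl ((isFactorwise_actTensor A B C).flipBase h)
  · refine Or.inr (Or.inl ?_)
    rw [map_map_comm (sw₁₂_actTensor A B C), map_map_comm (sw₁₂_actTensor A B C)]
    exact (isFactorwise_actTensor B A C).flipBase h
  · refine Or.inr (Or.inr ?_)
    rw [map_map_comm (sw₁₃_actTensor A B C), map_map_comm (sw₁₃_actTensor A B C)]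
    exact (isFactorwise_actTensor C B A).flipBase h

/-- **"Def. 2 is compatible with the action of the symmetry group … if some matrices `B^{(i)}` are
linearly dependent, then so are the matrices `V B^{(i)} W^{-1}`"** — for `g = A ⊗ B ⊗ C` acting
factorwise (any matrices; in particular every sandwich): if `S'` is a reduction of `S` then `g(S')`
is a reduction of `g(S)`, all six cases of Def. 2.
[cite: KauersMoosbauer2022FlipGraphs, §2 (paragraph after Def. 2)] -/
theorem Reduces.map_actTensor {S S' : Multiset (ι → κ → μ → K)} (hr : Reduces S S') :
    Reduces (S.map (actTensor A B C)) (S'.map (actTensor A B C)) := by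
  rcases hr with h | h | h | h | h | h
  · exact Or.inl ((isFactorwise_actTensor A B C).redBase h)
  · refine Or.inr (Or.inl ?_)
    rw [map_map_comm (sw₂₃_actTensor A B C), map_map_comm (sw₂₃_actTensor A B C)]
    exact (isFactorwise_actTensor A C B).redBase h
  · refine Or.inr (Or.inr (Or.inl ?_))
    rw [map_map_comm (sw₁₂_actTensor A B C), map_map_comm (sw₁₂_actTensor A B C)]
    exact (isFactorwise_actTensor B A C).redBase h
  · refine Or.inr (Or.inr (Or.inr (Or.inl ?_)))
    rw [map_map_comm (cyc_actTensor A B C), map_map_comm (cyc_actTensor A B C)]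
    exact (isFactorwise_actTensor B C A).redBase h
  · refine Or.inr (Or.inr (Or.inr (Or.inr (Or.inl ?_))))
    rw [map_map_comm (cyc₂_actTensor A B C), map_map_comm (cyc₂_actTensor A B C)]
    exact (isFactorwise_actTensor C A B).redBase h
  · refine Or.inr (Or.inr (Or.inr (Or.inr (Or.inr ?_))))
    rw [map_map_comm (sw₁₃_actTensor A B C), map_map_comm (sw₁₃_actTensor A B C)]
    exact (isFactorwise_actTensor C B A).redBase h

end Act

section Relabel

variable (e₁ : ι' → ι) (e₂ : κ' → κ) (e₃ : μ' → μ)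

omit [CommRing K] in
/-- `sw₁₂ ∘ relabel = relabel ∘ sw₁₂`. [folklore] -/
private theorem sw₁₂_relabel (T : ι → κ → μ → K) :
    sw₁₂ (relabel e₁ e₂ e₃ T) = relabel e₂ e₁ e₃ (sw₁₂ T) := rfl

omit [CommRing K] in
/-- `sw₂₃ ∘ relabel = relabel ∘ sw₂₃`. [folklore] -/
private theorem sw₂₃_relabel (T : ι → κ → μ → K) :
    sw₂₃ (relabel e₁ e₂ e₃ T) = relabel e₁ e₃ e₂ (sw₂₃ T) := rfl

omit [CommRing K] in
/-- `sw₁₃ ∘ relabel = relabel ∘ sw₁₃`. [folklore] -/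
private theorem sw₁₃_relabel (T : ι → κ → μ → K) :
    sw₁₃ (relabel e₁ e₂ e₃ T) = relabel e₃ e₂ e₁ (sw₁₃ T) := rfl

omit [CommRing K] in
/-- `cyc ∘ relabel = relabel ∘ cyc`. [folklore] -/
private theorem cyc_relabel (T : ι → κ → μ → K) :
    cyc (relabel e₁ e₂ e₃ T) = relabel e₂ e₃ e₁ (cyc T) := rfl

omit [CommRing K] in
/-- `cyc₂ ∘ relabel = relabel ∘ cyc₂`. [folklore] -/
private theorem cyc₂_relabel (T : ι → κ → μ → K) :
    cyc₂ (relabel e₁ e₂ e₃ T) = relabel e₃ e₁ e₂ (cyc₂ T) := rfl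

/-- Flips are preserved by index relabelings (all three cases of Def. 4).
[cite: KauersMoosbauer2022FlipGraphs, §3 (paragraph after Def. 4)] -/
theorem Flips.map_relabel {S S' : Multiset (ι → κ → μ → K)} (hf : Flips S S') :
    Flips (S.map (relabel e₁ e₂ e₃)) (S'.map (relabel e₁ e₂ e₃)) := by
  rcases hf with h | h | h
  · exact Or.inl ((isFactorwise_relabel e₁ e₂ e₃).flipBase h)
  · refine Or.inr (Or.inl ?_)
    rw [map_map_comm (sw₁₂_relabel e₁ e₂ e₃), map_map_comm (sw₁₂_relabel e₁ e₂ e₃)]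
    exact (isFactorwise_relabel e₂ e₁ e₃).flipBase h
  · refine Or.inr (Or.inr ?_)
    rw [map_map_comm (sw₁₃_relabel e₁ e₂ e₃), map_map_comm (sw₁₃_relabel e₁ e₂ e₃)]
    exact (isFactorwise_relabel e₃ e₂ e₁).flipBase h

/-- Reductions are preserved by index relabelings (all six cases of Def. 2).
[cite: KauersMoosbauer2022FlipGraphs, §2 (paragraph after Def. 2)] -/
theorem Reduces.map_relabel {S S' : Multiset (ι → κ → μ → K)} (hr : Reduces S S') :
    Reduces (S.map (relabel e₁ e₂ e₃)) (S'.map (relabel e₁ e₂ e₃)) := by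
  rcases hr with h | h | h | h | h | h
  · exact Or.inl ((isFactorwise_relabel e₁ e₂ e₃).redBase h)
  · refine Or.inr (Or.inl ?_)
    rw [map_map_comm (sw₂₃_relabel e₁ e₂ e₃), map_map_comm (sw₂₃_relabel e₁ e₂ e₃)]
    exact (isFactorwise_relabel e₁ e₃ e₂).redBase h
  · refine Or.inr (Or.inr (Or.inl ?_))
    rw [map_map_comm (sw₁₂_relabel e₁ e₂ e₃), map_map_comm (sw₁₂_relabel e₁ e₂ e₃)]
    exact (isFactorwise_relabel e₂ e₁ e₃).redBase h
  · refine Or.inr (Or.inr (Or.inr (Or.inl ?_)))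
    rw [map_map_comm (cyc_relabel e₁ e₂ e₃), map_map_comm (cyc_relabel e₁ e₂ e₃)]
    exact (isFactorwise_relabel e₂ e₃ e₁).redBase h
  · refine Or.inr (Or.inr (Or.inr (Or.inr (Or.inl ?_))))
    rw [map_map_comm (cyc₂_relabel e₁ e₂ e₃), map_map_comm (cyc₂_relabel e₁ e₂ e₃)]
    exact (isFactorwise_relabel e₃ e₁ e₂).redBase h
  · refine Or.inr (Or.inr (Or.inr (Or.inr (Or.inr ?_))))
    rw [map_map_comm (sw₁₃_relabel e₁ e₂ e₃), map_map_comm (sw₁₃_relabel e₁ e₂ e₃)]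
    exact (isFactorwise_relabel e₃ e₂ e₁).redBase h

end Relabel

end Transport

/-! ## §3 Flips and reductions under permutations of the three factors

"Def. 4 applies for arbitrary permutations of `A, B, Γ`"; "the definition [Def. 2] explicitly allows
any two factors to take the roles of `A` and `B`". The slot permutations `sw₂₃` and `cyc` generate
all six; the relations `Flips`, `Reduces` are invariant under both (their cases are permuted). -/

section Slots

variable {K : Type*} [CommRing K] {ι κ μ : Type*}

/-- `sw₂₃ (a⊗b⊗c) = a⊗c⊗b`. [folklore] -/
private theorem sw₂₃_triad' (a : ι → K) (b : κ → K) (c : μ → K) :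
    sw₂₃ (triad a b c) = triad a c b := by
  funext x y z; simp only [sw₂₃, triad_apply]; ring

omit [CommRing K] in
/-- `sw₂₃` is additive. [folklore] -/
private theorem sw₂₃_add [Add K] (x y : ι → κ → μ → K) : sw₂₃ (x + y) = sw₂₃ x + sw₂₃ y := rfl

omit [CommRing K] in
/-- `sw₂₃` is subtractive. [folklore] -/
private theorem sw₂₃_sub [Sub K] (x y : ι → κ → μ → K) : sw₂₃ (x - y) = sw₂₃ x - sw₂₃ y := rfl

omit [CommRing K] in
/-- `sw₂₃ ∘ sw₂₃ = id` on multisets. [folklore] -/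
private theorem map_sw₂₃_map_sw₂₃ (U : Multiset (ι → κ → μ → K)) : (U.map sw₂₃).map sw₂₃ = U := by
  rw [Multiset.map_map]; exact Multiset.map_id' U

omit [CommRing K] in
/-- `cyc₂ ∘ cyc = id` on multisets. [folklore] -/
private theorem map_cyc₂_map_cyc (U : Multiset (ι → κ → μ → K)) : (U.map cyc).map cyc₂ = U := by
  rw [Multiset.map_map]; exact Multiset.map_id' U

/-- The written case of Def. 4 is symmetric in `B` and `Γ`: exchanging the last two factors maps a
flip (sharing the first factor) to a flip sharing the first factor, the two choices of `T` being
exchanged. [cite: KauersMoosbauer2022FlipGraphs, Def. 4] -/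
theorem FlipBase.map_sw₂₃ {S S' : Multiset (ι → κ → μ → K)} (hf : FlipBase S S') :
    FlipBase (S.map sw₂₃) (S'.map sw₂₃) := by
  obtain ⟨a, b, b', c, c', R, hS, hS'⟩ := hf
  refine ⟨a, c, c', b, b', R.map sw₂₃, ?_, ?_⟩
  · simp only [hS, Multiset.map_cons, sw₂₃_triad']
  · rcases hS' with hS' | hS'
    · right
      simp only [hS', Multiset.map_cons, sw₂₃_add, sw₂₃_sub, sw₂₃_triad']
    · left
      simp only [hS', Multiset.map_cons, sw₂₃_add, sw₂₃_sub, sw₂₃_triad']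

/-- **Flips under the transposition of the last two factors**: "Def. 4 applies for arbitrary
permutations of `A, B, Γ`". [cite: KauersMoosbauer2022FlipGraphs, §3 (paragraph after Def. 4)] -/
theorem Flips.map_sw₂₃ {S S' : Multiset (ι → κ → μ → K)} (hf : Flips S S') :
    Flips (S.map sw₂₃) (S'.map sw₂₃) := by
  rcases hf with h | h | h
  · exact Or.inl h.map_sw₂₃
  · -- shared second factor ↦ shared third factor
    refine Or.inr (Or.inr ?_)
    have h' := h.map_sw₂₃
    rw [Multiset.map_map, Multiset.map_map] at h' ⊢
    exact h'
  · -- shared third factor ↦ shared second factor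
    refine Or.inr (Or.inl ?_)
    have h' := h.map_sw₂₃
    rw [Multiset.map_map, Multiset.map_map] at h' ⊢
    exact h'

/-- **Flips under the cyclic permutation of the factors**: "Def. 4 applies for arbitrary
permutations of `A, B, Γ`". [cite: KauersMoosbauer2022FlipGraphs, §3 (paragraph after Def. 4)] -/
theorem Flips.map_cyc {S S' : Multiset (ι → κ → μ → K)} (hf : Flips S S') :
    Flips (S.map cyc) (S'.map cyc) := by
  rcases hf with h | h | h
  · -- shared first factor ↦ shared third factor
    refine Or.inr (Or.inr ?_)
    have h' := h.map_sw₂₃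
    rw [Multiset.map_map, Multiset.map_map]
    exact h'
  · -- shared second factor ↦ shared first factor
    have h' := h.map_sw₂₃
    rw [Multiset.map_map, Multiset.map_map] at h'
    exact Or.inl h'
  · -- shared third factor ↦ shared second factor
    refine Or.inr (Or.inl ?_)
    rw [Multiset.map_map, Multiset.map_map]
    exact h

/-- **Reductions under the transposition of the last two factors**: the six cases of Def. 2 are
permuted. [cite: KauersMoosbauer2022FlipGraphs, §2 (paragraph after Def. 2)] -/
theorem Reduces.map_sw₂₃ {S S' : Multiset (ι → κ → μ → K)} (hr : Reduces S S') :
    Reduces (S.map sw₂₃) (S'.map sw₂₃) := by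
  rcases hr with h | h | h | h | h | h
  · refine Or.inr (Or.inl ?_)
    rw [map_sw₂₃_map_sw₂₃, map_sw₂₃_map_sw₂₃]; exact h
  · exact Or.inl h
  · refine Or.inr (Or.inr (Or.inr (Or.inr (Or.inl ?_))))
    rw [Multiset.map_map, Multiset.map_map]; exact h
  · refine Or.inr (Or.inr (Or.inr (Or.inr (Or.inr ?_))))
    rw [Multiset.map_map, Multiset.map_map]; exact h
  · refine Or.inr (Or.inr (Or.inl ?_))
    rw [Multiset.map_map, Multiset.map_map]; exact h
  · refine Or.inr (Or.inr (Or.inr (Or.inl ?_)))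
    rw [Multiset.map_map, Multiset.map_map]; exact h

/-- **Reductions under the cyclic permutation of the factors**: the six cases of Def. 2 are
permuted. [cite: KauersMoosbauer2022FlipGraphs, §2 (paragraph after Def. 2)] -/
theorem Reduces.map_cyc {S S' : Multiset (ι → κ → μ → K)} (hr : Reduces S S') :
    Reduces (S.map cyc) (S'.map cyc) := by
  rcases hr with h | h | h | h | h | h
  · refine Or.inr (Or.inr (Or.inr (Or.inr (Or.inl ?_))))
    rw [map_cyc₂_map_cyc, map_cyc₂_map_cyc]; exact h
  · refine Or.inr (Or.inr (Or.inr (Or.inr (Or.inr ?_))))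
    rw [Multiset.map_map, Multiset.map_map]; exact h
  · refine Or.inr (Or.inl ?_)
    rw [Multiset.map_map, Multiset.map_map]; exact h
  · exact Or.inl h
  · refine Or.inr (Or.inr (Or.inr (Or.inl ?_)))
    rw [Multiset.map_map, Multiset.map_map]; exact h
  · refine Or.inr (Or.inr (Or.inl ?_))
    rw [Multiset.map_map, Multiset.map_map]; exact h

/-- Flips under `cyc² = cyc₂`. [cite: KauersMoosbauer2022FlipGraphs, §3 (paragraph after Def. 4)] -/
theorem Flips.map_cyc₂ {S S' : Multiset (ι → κ → μ → K)} (hf : Flips S S') :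
    Flips (S.map cyc₂) (S'.map cyc₂) := by
  have h := hf.map_cyc.map_cyc
  rw [Multiset.map_map, Multiset.map_map] at h
  exact h

/-- Reductions under `cyc² = cyc₂`.
[cite: KauersMoosbauer2022FlipGraphs, §2 (paragraph after Def. 2)] -/
theorem Reduces.map_cyc₂ {S S' : Multiset (ι → κ → μ → K)} (hr : Reduces S S') :
    Reduces (S.map cyc₂) (S'.map cyc₂) := by
  have h := hr.map_cyc.map_cyc
  rw [Multiset.map_map, Multiset.map_map] at h
  exact h

end Slots

/-! ## §4 The symmetry group of `⟨n,n,n⟩`: edges between orbits do not depend on representatives -/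

section MatMul

variable {K : Type*} [Field K] {n : ℕ}

omit [Field K] in
/-- KM's transposition `τ` is the slot transposition `(2 3)` followed by transposing all indices.
[folklore] -/
private theorem mmap_transposeMap
    (U : Multiset ((Fin n × Fin n) → (Fin n × Fin n) → (Fin n × Fin n) → K)) :
    U.map (transposeMap n) = (U.map sw₂₃).map (relabel Prod.swap Prod.swap Prod.swap) := by
  rw [Multiset.map_map]; rfl

omit [Field K] in
/-- KM's cyclic shift `ρ` is the slot permutation `cyc` followed by a relabeling. [folklore] -/
private theorem mmap_cycleMap
    (U : Multiset ((Fin n × Fin n) → (Fin n × Fin n) → (Fin n × Fin n) → K)) :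
    U.map (cycleMap n) = (U.map cyc).map (relabel Prod.swap id Prod.swap) := by
  rw [Multiset.map_map]; rfl

omit [Field K] in
/-- `ρ⁻¹` is the slot permutation `cyc₂` followed by a relabeling. [folklore] -/
private theorem mmap_cycleMapInv
    (U : Multiset ((Fin n × Fin n) → (Fin n × Fin n) → (Fin n × Fin n) → K)) :
    U.map (cycleMapInv n) = (U.map cyc₂).map (relabel Prod.swap Prod.swap id) := by
  rw [Multiset.map_map]; rfl

/-- **Flips under KM's transposition** `A⊗B⊗Γ ↦ Bᵀ⊗Aᵀ⊗Γᵀ`.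
[cite: KauersMoosbauer2022FlipGraphs, §3 (paragraph after Def. 4)] -/
theorem Flips.map_transposeMap
    {S S' : Multiset ((Fin n × Fin n) → (Fin n × Fin n) → (Fin n × Fin n) → K)}
    (hf : Flips S S') :
    Flips (S.map (transposeMap n)) (S'.map (transposeMap n)) := by
  rw [mmap_transposeMap, mmap_transposeMap]
  exact hf.map_sw₂₃.map_relabel _ _ _

/-- **Reductions under KM's transposition** ("linear dependence is preserved under transposition").
[cite: KauersMoosbauer2022FlipGraphs, §2 (paragraph after Def. 2)] -/
theorem Reduces.map_transposeMap
    {S S' : Multiset ((Fin n × Fin n) → (Fin n × Fin n) → (Fin n × Fin n) → K)}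
    (hr : Reduces S S') :
    Reduces (S.map (transposeMap n)) (S'.map (transposeMap n)) := by
  rw [mmap_transposeMap, mmap_transposeMap]
  exact hr.map_sw₂₃.map_relabel _ _ _

/-- **Flips under KM's cyclic shift** `A⊗B⊗Γ ↦ B⊗Γ⊗A`.
[cite: KauersMoosbauer2022FlipGraphs, §3 (paragraph after Def. 4)] -/
theorem Flips.map_cycleMap
    {S S' : Multiset ((Fin n × Fin n) → (Fin n × Fin n) → (Fin n × Fin n) → K)}
    (hf : Flips S S') :
    Flips (S.map (cycleMap n)) (S'.map (cycleMap n)) := by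
  rw [mmap_cycleMap, mmap_cycleMap]
  exact hf.map_cyc.map_relabel _ _ _

/-- **Reductions under KM's cyclic shift.**
[cite: KauersMoosbauer2022FlipGraphs, §2 (paragraph after Def. 2)] -/
theorem Reduces.map_cycleMap
    {S S' : Multiset ((Fin n × Fin n) → (Fin n × Fin n) → (Fin n × Fin n) → K)}
    (hr : Reduces S S') :
    Reduces (S.map (cycleMap n)) (S'.map (cycleMap n)) := by
  rw [mmap_cycleMap, mmap_cycleMap]
  exact hr.map_cyc.map_relabel _ _ _

/-- Flips under the inverse cyclic shift.
[cite: KauersMoosbauer2022FlipGraphs, §3 (paragraph after Def. 4)] -/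
theorem Flips.map_cycleMapInv
    {S S' : Multiset ((Fin n × Fin n) → (Fin n × Fin n) → (Fin n × Fin n) → K)}
    (hf : Flips S S') :
    Flips (S.map (cycleMapInv n)) (S'.map (cycleMapInv n)) := by
  rw [mmap_cycleMapInv, mmap_cycleMapInv]
  exact hf.map_cyc₂.map_relabel _ _ _

/-- Reductions under the inverse cyclic shift.
[cite: KauersMoosbauer2022FlipGraphs, §2 (paragraph after Def. 2)] -/
theorem Reduces.map_cycleMapInv
    {S S' : Multiset ((Fin n × Fin n) → (Fin n × Fin n) → (Fin n × Fin n) → K)}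
    (hr : Reduces S S') :
    Reduces (S.map (cycleMapInv n)) (S'.map (cycleMapInv n)) := by
  rw [mmap_cycleMapInv, mmap_cycleMapInv]
  exact hr.map_cyc₂.map_relabel _ _ _

/-- **KM's symmetry group `G` of `⟨n,n,n⟩`** (§2), as a predicate on the symmetries of
`FlipGraphSymmetry.lean`. KM: "exchanging each rank-one tensor `A⊗B⊗Γ` by `Bᵀ⊗Aᵀ⊗Γᵀ` maps a
correct scheme to another correct scheme. A correct scheme is also obtained if we replace every
rank-one tensor `A⊗B⊗Γ` by `B⊗Γ⊗A`. Finally, if `U` is invertible, then … replacing every rank-one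
tensor `A⊗B⊗Γ` by `AU⊗U⁻¹B⊗Γ` maps a correct scheme to another one. These transformations generate
the symmetry group of `M_{n,m,p}`." Here: generated — under identity, inverses and composition —
by the transposition `transposeSq`, the cyclic shift `cycleSq`, and the sandwiches
`Symmetry.sandwich P Q R` (all `(U, V, W) ∈ GL(n,K)³`, de Groote; KM's `U`-sandwich together with
its conjugates by the cyclic shift gives these, so the generated group is the same).
[cite: KauersMoosbauer2022FlipGraphs, §2 (symmetry group)] -/
inductive InSymmetryGroup : Symmetry (matMulTensor K n n n) → Prop
  | sandwich (P Q R : Matrix (Fin n) (Fin n) K) (hP : IsUnit P.det) (hQ : IsUnit Q.det)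
      (hR : IsUnit R.det) : InSymmetryGroup (Symmetry.sandwich P Q R hP hQ hR)
  | cycle : InSymmetryGroup (Symmetry.cycleSq n)
  | transpose : InSymmetryGroup (Symmetry.transposeSq n)
  | refl : InSymmetryGroup (Symmetry.refl _)
  | symm {φ : Symmetry (matMulTensor K n n n)} : InSymmetryGroup φ → InSymmetryGroup φ.symm
  | trans {φ ψ : Symmetry (matMulTensor K n n n)} :
      InSymmetryGroup φ → InSymmetryGroup ψ → InSymmetryGroup (φ.trans ψ)

/-- **Flips and reductions are compatible with the symmetry group** (both printed statements at
once, for every `g ∈ G` and its inverse): if `S'` is a flip (reduction) of `S`, then `g(S')` is a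
flip (reduction) of `g(S)`.
[cite: KauersMoosbauer2022FlipGraphs, §2 (paragraph after Def. 2) and §3 (paragraph after
Def. 4)] -/
theorem InSymmetryGroup.map_flips_reduces {φ : Symmetry (matMulTensor K n n n)}
    (hφ : InSymmetryGroup φ) :
    (∀ S S', Flips S S' → Flips (S.map φ.toLinearEquiv) (S'.map φ.toLinearEquiv)) ∧
    (∀ S S', Reduces S S' → Reduces (S.map φ.toLinearEquiv) (S'.map φ.toLinearEquiv)) ∧
    (∀ S S', Flips S S' → Flips (S.map φ.toLinearEquiv.symm) (S'.map φ.toLinearEquiv.symm)) ∧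
    (∀ S S', Reduces S S' →
      Reduces (S.map φ.toLinearEquiv.symm) (S'.map φ.toLinearEquiv.symm)) := by
  induction hφ with
  | sandwich P Q R hP hQ hR =>
    refine ⟨fun S S' h => ?_, fun S S' h => ?_, fun S S' h => ?_, fun S S' h => ?_⟩
    · exact h.map_actTensor (P⁻¹ᵀ ⊗ₖ R⁻¹ᵀ) (P ⊗ₖ Q) (Q⁻¹ᵀ ⊗ₖ R)
    · exact h.map_actTensor (P⁻¹ᵀ ⊗ₖ R⁻¹ᵀ) (P ⊗ₖ Q) (Q⁻¹ᵀ ⊗ₖ R)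
    · exact h.map_actTensor (Pᵀ ⊗ₖ Rᵀ) (P⁻¹ ⊗ₖ Q⁻¹) (Qᵀ ⊗ₖ R⁻¹)
    · exact h.map_actTensor (Pᵀ ⊗ₖ Rᵀ) (P⁻¹ ⊗ₖ Q⁻¹) (Qᵀ ⊗ₖ R⁻¹)
  | cycle =>
    exact ⟨fun S S' h => h.map_cycleMap, fun S S' h => h.map_cycleMap,
      fun S S' h => h.map_cycleMapInv, fun S S' h => h.map_cycleMapInv⟩
  | transpose =>
    exact ⟨fun S S' h => h.map_transposeMap, fun S S' h => h.map_transposeMap,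
      fun S S' h => h.map_transposeMap, fun S S' h => h.map_transposeMap⟩
  | refl =>
    have e : ∀ U : Multiset ((Fin n × Fin n) → (Fin n × Fin n) → (Fin n × Fin n) → K),
        U.map (Symmetry.refl (matMulTensor K n n n)).toLinearEquiv = U := fun U => by
      simp [Symmetry.refl]
    have e' : ∀ U : Multiset ((Fin n × Fin n) → (Fin n × Fin n) → (Fin n × Fin n) → K),
        U.map (Symmetry.refl (matMulTensor K n n n)).toLinearEquiv.symm = U := fun U => by
      simp [Symmetry.refl]
    refine ⟨fun S S' h => ?_, fun S S' h => ?_, fun S S' h => ?_, fun S S' h => ?_⟩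
    · rw [e, e]; exact h
    · rw [e, e]; exact h
    · rw [e', e']; exact h
    · rw [e', e']; exact h
  | symm _ ih =>
    obtain ⟨h₁, h₂, h₃, h₄⟩ := ih
    exact ⟨h₃, h₄, h₁, h₂⟩
  | @trans φ ψ _ _ ihφ ihψ =>
    obtain ⟨h₁, h₂, h₃, h₄⟩ := ihφ
    obtain ⟨g₁, g₂, g₃, g₄⟩ := ihψ
    have e : ∀ U : Multiset ((Fin n × Fin n) → (Fin n × Fin n) → (Fin n × Fin n) → K),
        U.map (φ.trans ψ).toLinearEquiv = (U.map φ.toLinearEquiv).map ψ.toLinearEquiv := fun U => by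
      rw [Multiset.map_map]; rfl
    have e' : ∀ U : Multiset ((Fin n × Fin n) → (Fin n × Fin n) → (Fin n × Fin n) → K),
        U.map (φ.trans ψ).toLinearEquiv.symm =
          (U.map ψ.toLinearEquiv.symm).map φ.toLinearEquiv.symm := fun U => by
      rw [Multiset.map_map]; rfl
    refine ⟨fun S S' h => ?_, fun S S' h => ?_, fun S S' h => ?_, fun S S' h => ?_⟩
    · rw [e, e]; exact g₁ _ _ (h₁ _ _ h)
    · rw [e, e]; exact g₂ _ _ (h₂ _ _ h)
    · rw [e', e']; exact h₃ _ _ (g₃ _ _ h)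
    · rw [e', e']; exact h₄ _ _ (g₄ _ _ h)

/-- **"If `S'` is a flip of `S` and `g` is an element of the symmetry group, then `g(S')` is a flip
of `g(S)`."** [cite: KauersMoosbauer2022FlipGraphs, §3 (paragraph after Def. 4)] -/
theorem InSymmetryGroup.map_flips {φ : Symmetry (matMulTensor K n n n)} (hφ : InSymmetryGroup φ)
    {x y : Scheme (matMulTensor K n n n)} (h : Flips x.elts y.elts) :
    Flips (x.map φ).elts (y.map φ).elts :=
  hφ.map_flips_reduces.1 _ _ h

/-- **"Def. 2 is compatible with the action of the symmetry group"**: if `S'` is a reduction of `S`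
and `g ∈ G`, then `g(S')` is a reduction of `g(S)`.
[cite: KauersMoosbauer2022FlipGraphs, §2 (paragraph after Def. 2)] -/
theorem InSymmetryGroup.map_reduces {φ : Symmetry (matMulTensor K n n n)} (hφ : InSymmetryGroup φ)
    {x y : Scheme (matMulTensor K n n n)} (h : Reduces x.elts y.elts) :
    Reduces (x.map φ).elts (y.map φ).elts :=
  hφ.map_flips_reduces.2.1 _ _ h

/-- **The edges `E₁ ∪ E₂` of Def. 8 are compatible with the symmetry group**: `(S, S') ∈ E₁ ∪ E₂`
implies `(g(S), g(S')) ∈ E₁ ∪ E₂` for every `g ∈ G`.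
[cite: KauersMoosbauer2022FlipGraphs, Def. 8 with §2–§3 (compatibility paragraphs)] -/
theorem InSymmetryGroup.map_adj {φ : Symmetry (matMulTensor K n n n)} (hφ : InSymmetryGroup φ)
    {x y : Scheme (matMulTensor K n n n)} (h : Adj x y) : Adj (x.map φ) (y.map φ) := by
  rcases h with h | h
  · exact Or.inl (hφ.map_flips h)
  · exact Or.inr (hφ.map_reduces h)

/-- **"We can let the symmetry group act on the set of matrix multiplications and call two schemes
equivalent if they belong to the same orbit"** — the orbit relation of KM's group `G`
(`InSymmetryGroup`) on the schemes of `⟨n,n,n⟩`.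
[cite: KauersMoosbauer2022FlipGraphs, §2 (equivalence of schemes)] -/
def orbitSetoidKM (K : Type*) [Field K] (n : ℕ) : Setoid (Scheme (matMulTensor K n n n)) where
  r S S' := ∃ φ : Symmetry (matMulTensor K n n n), InSymmetryGroup φ ∧ S' = S.map φ
  iseqv :=
    { refl := fun S => ⟨Symmetry.refl _, InSymmetryGroup.refl, (Scheme.map_refl S).symm⟩
      symm := by
        rintro S S' ⟨φ, hφ, rfl⟩
        exact ⟨φ.symm, hφ.symm, (Scheme.map_map_symm φ S).symm⟩
      trans := by
        rintro S S' S'' ⟨φ, hφ, rfl⟩ ⟨ψ, hψ, rfl⟩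
        exact ⟨φ.trans ψ, hφ.trans hψ, (Scheme.map_trans φ ψ S).symm⟩ }

/-- **KM Def. 8 with KM's vertex set:** `V` = the orbits of the schemes of `⟨n,n,n⟩` under `G`,
edges `E₁ ∪ E₂` induced from representatives (`AdjQuot`).
[cite: KauersMoosbauer2022FlipGraphs, Def. 8] -/
def flipGraphKM (K : Type*) [Field K] (n : ℕ) :
    Quotient (orbitSetoidKM K n) → Quotient (orbitSetoidKM K n) → Prop :=
  AdjQuot (orbitSetoidKM K n)

/-- **Edges between orbits are well defined** (the point of the two compatibility paragraphs): the
orbit of `S'` is adjacent from the orbit of `S` iff `S` ITSELF has a flip or reduction equivalent to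
`S'` — every representative of the source orbit sees the edge.
[cite: KauersMoosbauer2022FlipGraphs, §3 (paragraph after Def. 4) with Def. 8] -/
theorem flipGraphKM_mk_iff (x y : Scheme (matMulTensor K n n n)) :
    flipGraphKM K n (Quotient.mk _ x) (Quotient.mk _ y) ↔
      ∃ y' : Scheme (matMulTensor K n n n), (orbitSetoidKM K n).r y y' ∧ Adj x y' := by
  constructor
  · rintro ⟨x₀, y₀, hx, hy, hadj⟩
    obtain ⟨φ, hφ, rfl⟩ : (orbitSetoidKM K n).r x₀ x := Quotient.exact hx
    refine ⟨y₀.map φ, ?_, hφ.map_adj hadj⟩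
    obtain ⟨ψ, hψ, rfl⟩ : (orbitSetoidKM K n).r y₀ y := Quotient.exact hy
    exact ⟨ψ.symm.trans φ, hψ.symm.trans hφ, by rw [Scheme.map_trans, Scheme.map_map_symm]⟩
  · rintro ⟨y', hy', hadj⟩
    exact ⟨x, y', rfl, (Quotient.sound hy').symm, hadj⟩

/-- **KM Thm. 9 on `G`-orbits**: the flip graph of Def. 8 with KM's own vertex set is connected as
an undirected graph. [cite: KauersMoosbauer2022FlipGraphs, Thm. 9] -/
theorem kauersMoosbauer2023_thm9_orbitsKM (p q : Quotient (orbitSetoidKM K n)) :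
    Relation.EqvGen (flipGraphKM K n) p q :=
  kauersMoosbauer2023_thm9_quot n n n _ p q

end MatMul

/-! ## §5 Def. 2 itself (for indexed families) under linear maps and permutations of the factors -/

section Families

variable {K : Type*} [Field K] {ι κ μ ι' κ' μ' σ : Type*}

/-- A line stays a line under an injective linear map:
`dim ⟨f(A^{(i)})⟩_{i∈I} = dim ⟨A^{(i)}⟩_{i∈I}`. [folklore] -/
private theorem finrank_span_image_eq (f : (ι → K) →ₗ[K] (ι' → K)) (hf : Function.Injective f)
    (w : σ → ι → K) (I : Set σ) :
    Module.finrank K (Submodule.span K ((fun s => f (w s)) '' I)) =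
      Module.finrank K (Submodule.span K (w '' I)) := by
  rw [← Set.image_image, Submodule.span_image]
  exact (LinearEquiv.finrank_eq (Submodule.equivMapOfInjective f hf _)).symm

/-- "If some matrices `B^{(i)}` (`i ∈ I`) are linearly dependent, then so are the matrices
`V B^{(i)} W^{-1}`" — for any linear map.
[cite: KauersMoosbauer2022FlipGraphs, §2 (paragraph after Def. 2)] -/
theorem not_linearIndepOn_map_of_not_linearIndepOn (g : (κ → K) →ₗ[K] (κ' → K)) {u : σ → κ → K}
    {I : Set σ} (h : ¬ LinearIndepOn K u I) : ¬ LinearIndepOn K (fun s => g (u s)) I :=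
  fun h' => h (h'.of_comp g)

/-- **"Def. 2 is compatible with the action of the symmetry group"** — the sandwich / transposition
part for indexed families: reducibility of `(A^{(i)} ⊗ B^{(i)} ⊗ Γ^{(i)})_i` implies reducibility
of `(f A^{(i)} ⊗ g B^{(i)} ⊗ h Γ^{(i)})_i` for injective linear maps `f, g, h` of the factors (e.g.
`A ↦ U A V^{-1}`, or `A ↦ Aᵀ`): the line condition is preserved by injectivity, the dependence
condition by linearity. [cite: KauersMoosbauer2022FlipGraphs, §2 (paragraph after Def. 2)] -/
theorem Reducible.map_linear (f : (ι → K) →ₗ[K] (ι' → K)) (g : (κ → K) →ₗ[K] (κ' → K))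
    (h : (μ → K) →ₗ[K] (μ' → K)) (hf : Function.Injective f) (hg : Function.Injective g)
    (hh : Function.Injective h) {w : σ → ι → K} {u : σ → κ → K} {v : σ → μ → K}
    (hred : Reducible w u v) :
    Reducible (fun s => f (w s)) (fun s => g (u s)) (fun s => h (v s)) := by
  obtain ⟨I, hI, hc⟩ := hred
  refine ⟨I, hI, ?_⟩
  rw [finrank_span_image_eq f hf, finrank_span_image_eq g hg, finrank_span_image_eq h hh]
  rcases hc with ⟨h1, h2⟩ | ⟨h1, h2⟩ | ⟨h1, h2⟩
  · exact Or.inl ⟨h1, h2.imp (not_linearIndepOn_map_of_not_linearIndepOn g)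
      (not_linearIndepOn_map_of_not_linearIndepOn h)⟩
  · exact Or.inr (Or.inl ⟨h1, h2.imp (not_linearIndepOn_map_of_not_linearIndepOn f)
      (not_linearIndepOn_map_of_not_linearIndepOn h)⟩)
  · exact Or.inr (Or.inr ⟨h1, h2.imp (not_linearIndepOn_map_of_not_linearIndepOn f)
      (not_linearIndepOn_map_of_not_linearIndepOn g)⟩)

/-- **"The definition explicitly allows any two factors to take the roles of `A` and `B`"**:
Def. 2 is invariant under exchanging the first two factors …
[cite: KauersMoosbauer2022FlipGraphs, §2 (paragraph after Def. 2)] -/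
theorem Reducible.swap {w : σ → ι → K} {u : σ → κ → K} {v : σ → μ → K} (hred : Reducible w u v) :
    Reducible u w v := by
  obtain ⟨I, hI, hc⟩ := hred
  exact ⟨I, hI, by tauto⟩

/-- … and under the cyclic permutation of the factors (hence under all of `S₃`).
[cite: KauersMoosbauer2022FlipGraphs, §2 (paragraph after Def. 2)] -/
theorem Reducible.cycle {w : σ → ι → K} {u : σ → κ → K} {v : σ → μ → K} (hred : Reducible w u v) :
    Reducible u v w := by
  obtain ⟨I, hI, hc⟩ := hred
  exact ⟨I, hI, by tauto⟩

end Families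

end FlipGraph

end Literature.Computability.AlgebraicComplexity
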